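import Mathlib
import Literature.Computability.Complexity.CNF
import Summits.PneNP.PneNP.Theorems.OverlapGapAlgebraSearchHardWindowVanishingLowDegree
import Literature.Computability.Complexity.RandomKSatLowDegreeHardness

/-!
# Route OverlapGapAlgebra, crux `SearchHardWindow` (stmt-PneNP-2460): low-degree BOOLEAN search
# maps solve random `k`-SAT in the window with probability `→ 0`; the crux's hardness conjunct for
# solvers with low-degree sections (unconditional)

Corollaries of `vanishingLowDegreeHardness` (`…VanishingLowDegree.lean`), with no hypothesis and no
named fact:

* `vanishingLowDegreeBoolean` — for `k ≥ k₀` and every degree sequence `D_n = o(n/log² n)`: every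
  sequence of search maps `g_n : instances → assignments` each of whose `n` output bits, as a
  `±1`-valued function of the `m·k` literal slots, has coordinate (Efron–Stein) degree `≤ D_n`,
  outputs a satisfying assignment of `F_k(n, ⌊5·2^k log k/k · n⌋)` with probability `→ 0`
  (eventually `≤ ε · #Inst` for every `ε > 0`). A Boolean map is its own saturated real relaxation
  (`|±1| = 1`, energy `n · #Inst`), so the saturation and energy provisos of the real-valued theorem
  disappear. Covers, e.g., maps each of whose output bits reads (adaptively or not) at most `D_n`
  literal slots.
* `hardnessConjunct_lowDegree` — the hardness conjunct of the crux `SearchHardWindow` at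
  `(k, α_k)`, VERBATIM (success ratio eventually `≤ ε`, every `ε > 0`), for ANY
  `f : List Bool → List Bool` — no complexity hypothesis — whose decoded section
  `Φ ↦ (v ↦ (f ⌜Φ⌝).getD v false)` has, eventually in `n`, output bits of coordinate degree `≤ D_n`,
  `D_n = o(n/log² n)`. What the crux asserts beyond this is the same conclusion for polynomial-time
  `f` whose sections are NOT of low coordinate degree.

References: B. Huang, M. Sellke, arXiv:2501.06427, Cor. 3.21 [HuangSellke2025]; G. Bresler,
B. Huang, arXiv:2106.02129, Thm. 2.6 [BreslerHuang2022].
-/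

namespace Summit.PneNP.PneNP.Theorems

set_option linter.dupNamespace false -- `Summit.PneNP.PneNP.…`: summit = sub-problem (D-0017)

open Finset Filter Asymptotics
open Literature.Computability.Complexity (IsCoordDegreeLE)
open scoped Classical

/-- **Low-degree Boolean search maps fail with probability `→ 0` (unconditional).** For `k ≥ k₀`
and every `D_n = o(n/log² n)`: if every output bit of `g_n`, as the `±1`-valued function
`y ↦ (if g_n (curry y) v then 1 else -1)` of the literal slots, has coordinate degree `≤ D_n`, then
for every `ε > 0`, eventually in `n`, `g_n` satisfies at most `ε · #Inst` instances of
`F_k(n, ⌊5·2^k log k/k · n⌋)`. [HuangSellke2025, Cor. 3.21] -/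
theorem vanishingLowDegreeBoolean :
    ∃ k₀ : ℕ, ∀ k : ℕ, k₀ ≤ k → ∀ D : ℕ → ℕ,
      (fun n : ℕ => (D n : ℝ)) =o[atTop] (fun n : ℕ => (n : ℝ) / Real.log n ^ 2) →
      ∀ g : (n : ℕ) → (m : ℕ) → (Fin m → Fin k → Fin n × Bool) → (Fin n → Bool),
        (∀ (n m : ℕ) (v : Fin n), IsCoordDegreeLE (D n)
            (fun y : Fin m × Fin k → Fin n × Bool =>
              if g n m (Function.curry y) v then (1 : ℝ) else -1)) →
        ∀ ε : ℝ, 0 < ε → ∀ᶠ n : ℕ in atTop, ∀ m : ℕ, m = ⌊5 * 2 ^ k * Real.log k / k * n⌋₊ →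
          ((univ.filter fun Φ : Fin m → Fin k → Fin n × Bool =>
              ∀ i : Fin m, ∃ j : Fin k, g n m Φ (Φ i j).1 = (Φ i j).2).card : ℝ)
            ≤ ε * Fintype.card (Fin m → Fin k → Fin n × Bool) := by
  obtain ⟨k₀, hk₀⟩ := vanishingLowDegreeHardness
  refine ⟨k₀, fun k hk D hD g hdeg ε hε => ?_⟩
  -- the `±1` relaxation of `g`
  set F : (n : ℕ) → (m : ℕ) → (Fin m → Fin k → Fin n × Bool) → Fin n → ℝ :=
    fun n m Φ v => if g n m Φ v then 1 else -1 with hF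
  have hener : ∀ n m : ℕ, m = ⌊5 * 2 ^ k * Real.log k / k * n⌋₊ →
      ∑ Φ : Fin m → Fin k → Fin n × Bool, ∑ v : Fin n, F n m Φ v ^ 2
        ≤ 1 * n * Fintype.card (Fin m → Fin k → Fin n × Bool) := by
    intro n m _
    have hsq : ∀ (Φ : Fin m → Fin k → Fin n × Bool) (v : Fin n), F n m Φ v ^ 2 = 1 := by
      intro Φ v
      simp only [hF]
      split_ifs <;> norm_num
    simp only [hsq, sum_const, card_univ, Fintype.card_fin, nsmul_eq_mul, mul_one]
    linarith
  have h := hk₀ k hk 1 one_pos D hD F (fun n m v => hdeg n m v) hener ε hε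
  filter_upwards [h] with n hn m hm
  have hset : (univ.filter fun Φ : Fin m → Fin k → Fin n × Bool =>
      ∀ i : Fin m, ∃ j : Fin k, g n m Φ (Φ i j).1 = (Φ i j).2) =
      (univ.filter fun Φ : Fin m → Fin k → Fin n × Bool =>
        (∀ v : Fin n, 1 ≤ |F n m Φ v|) ∧
        ∀ i : Fin m, ∃ j : Fin k, decide (0 ≤ F n m Φ (Φ i j).1) = (Φ i j).2) := by
    refine Finset.filter_congr fun Φ _ => ?_
    have hsat : ∀ v : Fin n, 1 ≤ |F n m Φ v| := fun v => by
      simp only [hF]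
      split_ifs <;> norm_num
    have hdec : ∀ v : Fin n, decide (0 ≤ F n m Φ v) = g n m Φ v := fun v => by
      simp only [hF]
      by_cases hb : g n m Φ v = true
      · simp [hb]
      · simp [hb]
    simp only [hdec, hsat, implies_true, true_and]
  rw [hset]
  exact hn m hm

/-- **The crux's hardness conjunct for solvers with low-degree sections (verbatim shape,
unconditional).** For `k ≥ k₀` and ANY `f : List Bool → List Bool` (no complexity hypothesis): if,
eventually in `n` (`m = ⌊5·2^k log k/k · n⌋`), every output bit of the decoded section
`Φ ↦ (v ↦ (f ⌜Φ⌝).getD v false)` has coordinate degree `≤ D_n` in the literal slots, with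
`D_n = o(n/log² n)`, then the success ratio of `f` on `F_k(n, m)` is eventually `≤ ε` for every
`ε > 0` — the inner conjunct of `SearchHardWindow` at `(k, α_k)`. [HuangSellke2025, Cor. 3.21] -/
theorem hardnessConjunct_lowDegree :
    ∃ k₀ : ℕ, ∀ k : ℕ, k₀ ≤ k → ∀ (f : List Bool → List Bool) (D : ℕ → ℕ),
      (fun n : ℕ => (D n : ℝ)) =o[atTop] (fun n : ℕ => (n : ℝ) / Real.log n ^ 2) →
      (∀ᶠ n : ℕ in atTop, ∀ m : ℕ, m = ⌊5 * 2 ^ k * Real.log k / k * n⌋₊ → ∀ v : Fin n,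
        IsCoordDegreeLE (D n) (fun y : Fin m × Fin k → Fin n × Bool =>
          if (f (Literature.Computability.Complexity.encodingCNF.encode (List.ofFn fun a =>
              List.ofFn fun b => (((Function.curry y a b).1 : ℕ), (Function.curry y a b).2)))).getD
                v false
          then (1 : ℝ) else -1)) →
      ∀ ε : ℝ, 0 < ε → ∀ᶠ n : ℕ in Filter.atTop, ∀ m : ℕ, m = ⌊5 * 2 ^ k * Real.log k / k * n⌋₊ →
        ((Finset.univ.filter fun Φ : Fin m → Fin k → Fin n × Bool => ∀ i, ∃ j,
            (f (Literature.Computability.Complexity.encodingCNF.encode (List.ofFn fun a =>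
              List.ofFn fun b => (((Φ a b).1 : ℕ), (Φ a b).2)))).getD (Φ i j).1 false =
                (Φ i j).2).card : ℝ) / Fintype.card (Fin m → Fin k → Fin n × Bool) ≤ ε := by
  obtain ⟨k₀, hk₀⟩ := vanishingLowDegreeBoolean
  refine ⟨k₀, fun k hk f D hD hf ε hε => ?_⟩
  -- the decoded section, frozen to a constant where the degree hypothesis fails
  set dec : (n : ℕ) → (m : ℕ) → (Fin m → Fin k → Fin n × Bool) → (Fin n → Bool) :=
    fun n m Φ v => (f (Literature.Computability.Complexity.encodingCNF.encode (List.ofFn fun a =>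
      List.ofFn fun b => (((Φ a b).1 : ℕ), (Φ a b).2)))).getD v false with hdec
  set good : ℕ → ℕ → Prop := fun n m => ∀ v : Fin n, IsCoordDegreeLE (D n)
    (fun y : Fin m × Fin k → Fin n × Bool => if dec n m (Function.curry y) v then (1 : ℝ) else -1)
    with hgood
  set g : (n : ℕ) → (m : ℕ) → (Fin m → Fin k → Fin n × Bool) → (Fin n → Bool) :=
    fun n m Φ v => if good n m then dec n m Φ v else false with hg
  have hdeg : ∀ (n m : ℕ) (v : Fin n), IsCoordDegreeLE (D n)
      (fun y : Fin m × Fin k → Fin n × Bool => if g n m (Function.curry y) v then (1 : ℝ) else -1) := by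
    intro n m v
    by_cases hgm : good n m
    · have := hgm v
      simp only [hg, hgm, if_true]
      exact this
    · simp only [hg, hgm, if_false]
      exact IsCoordDegreeLE.const _ _
  have h := hk₀ k hk D hD g hdeg ε hε
  filter_upwards [h, hf] with n hn hfn m hm
  have hgm : good n m := fun v => hfn m hm v
  have hset : ((Finset.univ.filter fun Φ : Fin m → Fin k → Fin n × Bool => ∀ i, ∃ j,
      (f (Literature.Computability.Complexity.encodingCNF.encode (List.ofFn fun a =>
        List.ofFn fun b => (((Φ a b).1 : ℕ), (Φ a b).2)))).getD (Φ i j).1 false = (Φ i j).2))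
      = (Finset.univ.filter fun Φ : Fin m → Fin k → Fin n × Bool =>
          ∀ i, ∃ j, g n m Φ (Φ i j).1 = (Φ i j).2) := by
    refine Finset.filter_congr fun Φ _ => ?_
    simp only [hg, hgm, if_true, hdec]
  rw [hset]
  have hle := hn m hm
  by_cases hN : (Fintype.card (Fin m → Fin k → Fin n × Bool) : ℝ) = 0
  · rw [hN, div_zero]; exact hε.le
  · have hNpos : (0 : ℝ) < Fintype.card (Fin m → Fin k → Fin n × Bool) :=
      lt_of_le_of_ne (Nat.cast_nonneg _) (Ne.symm hN)
    rw [div_le_iff₀ hNpos]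
    exact hle

end Summit.PneNP.PneNP.Theorems
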